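import Mathlib
import Summits.NavierStokesRegularity.NavierStokesRegularity.Theorems.TaoLadderRungTwoBreakBlowupRigidityOneLocalLawClosure
import Summits.NavierStokesRegularity.NavierStokesRegularity.Theorems.TaoLadderRungTwoBreakBlowupRigidityOneClockFromPinning
import HarnessLib

/-!
# THE TYPE-I-FREE EXTRACTION: a CLOCKED FRONT (amplitude ceiling `B ν^j`, per-shell action ceiling, firing floor with a
  two-sided self-similar clock at ratio `ν² ≥ (1+ε₀)^{-a}`) has an admissible, forward (S_a)-surviving eternal ω-limit —
  the conclusion of `stub_eternalFromBlowup` of K2(1) `TaoLadderRungTwoBreak.BlowupRigidityOne`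
  (stmt-NavierStokesRegularity-20206) WITHOUT the sup-norm type-I hypothesis (cell risk N-39)

MODEL lattice ODEs only (Tao 2016 §4 (4.8)/(4.12), §6.4); nothing here is a statement about the Navier–Stokes equations;
NO item is closed (`--supports stmt-NavierStokesRegularity-20206`). Route-independent (general `m`; `m = 4` in the
stub-shaped corollary).

Observation: the firing-centred translates `W̃_{n+j}(u - log(T-τ_j))` of the renormalised flow are bounded SHELL-BY-SHELL by
the front data alone — `‖W̃_{n+j}(u + s_j)‖ = Λ^{n+j} e^{-u} (T-τ_j) ‖x_{n+j}‖ ≤ B √κ₂ e^{-u} (Λν)^n` from the amplitude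
ceiling and the UPPER clock `(Λ²ν²)^j (T-τ_j)² ≤ κ₂`. With the LOCAL closure `eternalLaw_of_continuousLimit_local` this
replaces the type-I bound everywhere in the extraction (law, action, envelope, survival); only `UniformBound` of the limit
is lost — which the registered stub `stub_eternalFromBlowup` does not ask for.

* `eternal_surviving_of_clockedFront` — **general exponent `a`**: exact flow on `[0,T)` + action ceiling + amplitude ceiling
  `B ν^j` + firing times with floor `c_f (ν²)^k` and clock `κ₁ ≤ (Λ²ν²)^k (T-τ_k)² ≤ κ₂` + `Λ²ν² > 1` + `1 ≤ physWeight a ε₀·Λ²ν²`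
  ⇒ `∃ W, IsEternal ε₀ α W ∧ EternalSurvivingFwd a ε₀ W`;
* `eternal_surviving_one_of_clockedFront` — `a = 1` under `(1+ε₀)⁻¹ ≤ ν²` (thresholds automatic);
* `stub_eternalFromBlowup_of_clockedFronts` — the REGISTERED STUB SIGNATURE verbatim from the TYPE-I-FREE front bundle
  {action ceiling, amplitude ceiling, clocked firing floor at an (S₁)-surviving ratio} attached to every robust blow-up below
  threshold.

HONEST LABEL: the front bundle is OPEN for robust inviscid blow-up of a fixed-spread table (asymptotic self-similarity of
the blow-up front, (E2)); type I (N-39) is no longer on the list for ⟨20206⟩'s extraction stub (it stays on the list of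
K2ᵛ ⟨20420⟩, which asks `UniformBound`). `stub_eternalIsDSS` untouched. No stub, crux or summit is proved here.
-/

noncomputable section

-- the summit and its single sub-problem share the name (CONVENTIONS §1)
set_option linter.dupNamespace false

open Set Filter Topology MeasureTheory

namespace Summit.NavierStokesRegularity.NavierStokesRegularity.Theorems

namespace BlowupRigidityOne

open Literature.Analysis.FluidPDE Literature.Analysis.FluidPDE.TaoCascade
open Summit.NavierStokesRegularity.NavierStokesRegularity.Cruxes.MinimalBlowupExtraction.Extraction
  (exists_subseq_continuousLimit)

variable {m : ℕ}

/-- **THE TYPE-I-FREE EXTRACTION FROM A CLOCKED FRONT (general exponent `a`).** Let `X` be an exact flow of `α` on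
`[0,T)` (`T > 0`) with renormalisation `W̃`; assume the per-shell ACTION CEILING `Λ^k ∫_{[0,T)}‖x_k‖ ≤ A`, the AMPLITUDE
CEILING `‖x_j(t)‖ ≤ B ν^j` (`ν > 0`), firing times `τ_k ∈ [0,T)` (`k ∈ ℕ`) with FLOOR `c_f (ν²)^k ≤ ‖x_k(τ_k)‖²` and the
two-sided CLOCK `κ₁ ≤ (Λ²ν²)^k (T-τ_k)² ≤ κ₂`, `Λ²ν² > 1`, and `1 ≤ physWeight a ε₀ · Λ²ν²`. Then some continuous limit `W`
of the firing-centred translates is an ADMISSIBLE eternal solution, `IsEternal ε₀ α W`, that is FORWARD (S_a)-SURVIVING,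
`EternalSurvivingFwd a ε₀ W`. No type-I bound is assumed: the translates are bounded shell-by-shell by
`B √κ₂ e^{-u} (Λν)^n` (amplitude ceiling × upper clock), which feeds the LOCAL closure and the admissibility passage.
[cite: Tao2016AveragedNS, §4 Thm. 4.2 (statement shape), (4.8)–(4.10), §6.4; KochNadirashviliSereginSverak2009, Thm 1.1 ff. (rescaling-compactness); Teschl2012, §2.6; cell vocabulary (`IsEternal`, `EternalSurvivingFwd`)] -/
theorem eternal_surviving_of_clockedFront {ε₀ T A B ν cf κ₁ κ₂ a : ℝ} (hε : 0 < ε₀) (hT : 0 < T)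
    {α : Fin m → Fin m → Fin m → ℤ × ℤ × ℤ → ℝ}
    {X : Fin m → ℤ → ℝ → ℝ} (hC1 : ∀ i n, ContDiffOn ℝ 1 (X i n) (Set.Ico 0 T))
    (hmot : ∀ i n t, 0 ≤ t → t < T → derivWithin (X i n) (Set.Ici 0) t = quadTerm ε₀ α X i n t)
    {W : ℤ → ℝ → Em m}
    (hW : ∀ n σ, W n σ = (bigLam ε₀ ^ n * Real.exp (-σ)) • shellVec X n (T - Real.exp (-σ)))
    (hact : ∀ k : ℤ, IntegrableOn (fun t => ‖shellVec X k t‖) (Ico 0 T) ∧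
      bigLam ε₀ ^ k * (∫ t in Ico 0 T, ‖shellVec X k t‖) ≤ A)
    (hν : 0 < ν) (hamp : ∀ (j : ℤ) (t : ℝ), 0 ≤ t → t < T → ‖shellVec X j t‖ ≤ B * ν ^ j)
    {τ : ℕ → ℝ} (hτ : ∀ k : ℕ, 0 ≤ τ k ∧ τ k < T)
    (hfloor : ∀ k : ℕ, cf * (ν ^ 2) ^ k ≤ ‖shellVec X (k : ℤ) (τ k)‖ ^ 2)
    (hclock₁ : ∀ k : ℕ, κ₁ ≤ (bigLam ε₀ ^ 2 * ν ^ 2) ^ k * (T - τ k) ^ 2)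
    (hclock₂ : ∀ k : ℕ, (bigLam ε₀ ^ 2 * ν ^ 2) ^ k * (T - τ k) ^ 2 ≤ κ₂)
    (hcf : 0 < cf) (hκ₁ : 0 < κ₁) (hκ₂ : 0 < κ₂) (hq1 : 1 < bigLam ε₀ ^ 2 * ν ^ 2)
    (hpw : 1 ≤ physWeight a ε₀ * (bigLam ε₀ ^ 2 * ν ^ 2)) :
    ∃ Wlim : ℤ → ℝ → Em m, IsEternal ε₀ α Wlim ∧ EternalSurvivingFwd a ε₀ Wlim := by
  have hΛ : 0 < bigLam ε₀ := bigLam_pos (by linarith)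
  have hB : 0 ≤ B := by
    have h := hamp 0 0 le_rfl hT
    rw [zpow_zero, mul_one] at h
    exact (norm_nonneg _).trans h
  set q : ℝ := bigLam ε₀ ^ 2 * ν ^ 2 with hq_def
  have hq : 0 < q := by positivity
  set ρ : ℝ := bigLam ε₀ * ν with hρ_def
  have hρ : 0 < ρ := by positivity
  have hρq : ρ ^ 2 = q := by rw [hρ_def, hq_def]; ring
  have hρ1 : 1 ≤ ρ := by
    by_contra h
    push Not at h
    have : ρ ^ 2 < 1 := pow_lt_one₀ hρ.le h two_ne_zero
    linarith
  have gap : ∀ j : ℕ, 0 < T - τ j := fun j => by linarith [(hτ j).2]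
  -- the upper clock in amplitude form: `ρ^j (T - τ_j) ≤ √κ₂`
  have hup : ∀ j : ℕ, ρ ^ j * (T - τ j) ≤ Real.sqrt κ₂ := by
    intro j
    have h : (ρ ^ j * (T - τ j)) ^ 2 ≤ κ₂ := by
      rw [mul_pow, ← pow_mul, mul_comm j 2, pow_mul, hρq]; exact hclock₂ j
    exact (le_abs_self _).trans (Real.abs_le_sqrt h)
  -- the centring: shell shift `j`, log-time shift `s_j = -log(T - τ_j) → +∞`
  set s : ℕ → ℝ := fun j => -Real.log (T - τ j) with hs_def
  have hs : Tendsto s atTop atTop := by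
    have hlq : 0 < Real.log q := Real.log_pos hq1
    have hlow : ∀ j : ℕ, ((j : ℝ) * Real.log q + -Real.log κ₂) / 2 ≤ s j := by
      intro j
      have h1 : (T - τ j) ^ 2 ≤ κ₂ / q ^ j := by
        rw [le_div_iff₀ (pow_pos hq j), mul_comm]; exact hclock₂ j
      have h2 : Real.log ((T - τ j) ^ 2) ≤ Real.log (κ₂ / q ^ j) := Real.log_le_log (pow_pos (gap j) 2) h1
      rw [Real.log_pow, Real.log_div hκ₂.ne' (pow_pos hq j).ne', Real.log_pow] at h2
      push_cast at h2
      show ((j : ℝ) * Real.log q + -Real.log κ₂) / 2 ≤ -Real.log (T - τ j)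
      linarith
    exact tendsto_atTop_mono hlow ((tendsto_atTop_add_const_right _ _
      (tendsto_natCast_atTop_atTop.atTop_mul_const hlq)).atTop_div_const two_pos)
  -- windows and the law of the translates
  set av : ℕ → ℝ := fun j => -Real.log T - s j with hav_def
  have hwin : ∀ (j : ℕ) (u : ℝ), av j < u → Real.exp (-(u + s j)) < T := by
    intro j u hu
    have hu' : -(u + s j) < Real.log T := by
      have : -Real.log T - s j < u := hu
      linarith
    calc Real.exp (-(u + s j)) < Real.exp (Real.log T) := Real.exp_lt_exp.2 hu'
      _ = T := Real.exp_log hT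
  have hav : Tendsto av atTop atBot := by
    refine tendsto_atBot.2 fun b => ?_
    exact (hs.eventually (eventually_ge_atTop (-Real.log T - b))).mono fun j hj => by
      show -Real.log T - s j ≤ b
      linarith
  set g : ℕ → ℤ → ℝ → Em m := fun j n u => W (n + (j : ℤ)) (u + s j) with hg_def
  have hlawg : ∀ (j : ℕ) (n : ℤ) (u : ℝ), av j < u → HasDerivAt (g j n)
      (-((1 : ℝ) • g j n u) + tableQ α (g j n u) + bigLam ε₀ • tableA α (g j (n - 1) u)
        + (bigLam ε₀)⁻¹ • tableB α (g j (n + 1) u) (g j n u)) u := by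
    intro j n u hu
    have h := (renormalisedFlow_law hε hC1 hmot hW (n + (j : ℤ)) (hwin j u hu)).comp_add_const u (s j)
    have e1 : n + (j : ℤ) - 1 = n - 1 + (j : ℤ) := by ring
    have e2 : n + (j : ℤ) + 1 = n + 1 + (j : ℤ) := by ring
    rw [e1, e2] at h
    exact h
  -- THE LOCAL BOUND from the front: `‖g j n u‖ ≤ B √κ₂ e^{-u} ρ^n`
  have hgb : ∀ (j : ℕ) (n : ℤ) (u : ℝ), av j < u → ‖g j n u‖ ≤ B * Real.sqrt κ₂ * Real.exp (-u) * ρ ^ n := by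
    intro j n u hu
    have hwu := hwin j u hu
    have ht0 : 0 ≤ T - Real.exp (-(u + s j)) := by linarith
    have htT : T - Real.exp (-(u + s j)) < T := by linarith [Real.exp_pos (-(u + s j))]
    have hx := hamp (n + (j : ℤ)) _ ht0 htT
    have hexp : Real.exp (-(u + s j)) = Real.exp (-u) * (T - τ j) := by
      rw [neg_add, Real.exp_add, hs_def]
      simp only [neg_neg]
      rw [Real.exp_log (gap j)]
    have hnorm : ‖g j n u‖ = bigLam ε₀ ^ (n + (j : ℤ)) * Real.exp (-(u + s j)) *
        ‖shellVec X (n + (j : ℤ)) (T - Real.exp (-(u + s j)))‖ := renormalisedFlow_norm hε hW _ _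
    rw [hnorm, hexp]
    have hΛk : 0 < bigLam ε₀ ^ (n + (j : ℤ)) := zpow_pos hΛ _
    have hsplit : bigLam ε₀ ^ (n + (j : ℤ)) * (B * ν ^ (n + (j : ℤ))) = B * ρ ^ n * ρ ^ j := by
      rw [hρ_def, mul_zpow, ← zpow_natCast (bigLam ε₀ * ν) j, mul_zpow, zpow_add₀ hΛ.ne', zpow_add₀ hν.ne']
      ring
    calc bigLam ε₀ ^ (n + (j : ℤ)) * (Real.exp (-u) * (T - τ j)) *
          ‖shellVec X (n + (j : ℤ)) (T - Real.exp (-u) * (T - τ j))‖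
        ≤ bigLam ε₀ ^ (n + (j : ℤ)) * (Real.exp (-u) * (T - τ j)) * (B * ν ^ (n + (j : ℤ))) := by
          refine mul_le_mul_of_nonneg_left ?_ (mul_nonneg hΛk.le (mul_nonneg (Real.exp_pos _).le (gap j).le))
          rw [← hexp]; exact hx
      _ = B * Real.exp (-u) * ρ ^ n * (ρ ^ j * (T - τ j)) := by
          have := hsplit
          calc bigLam ε₀ ^ (n + (j : ℤ)) * (Real.exp (-u) * (T - τ j)) * (B * ν ^ (n + (j : ℤ)))
              = Real.exp (-u) * (T - τ j) * (bigLam ε₀ ^ (n + (j : ℤ)) * (B * ν ^ (n + (j : ℤ)))) := by ring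
            _ = Real.exp (-u) * (T - τ j) * (B * ρ ^ n * ρ ^ j) := by rw [hsplit]
            _ = B * Real.exp (-u) * ρ ^ n * (ρ ^ j * (T - τ j)) := by ring
      _ ≤ B * Real.exp (-u) * ρ ^ n * Real.sqrt κ₂ :=
          mul_le_mul_of_nonneg_left (hup j) (by positivity)
      _ = B * Real.sqrt κ₂ * Real.exp (-u) * ρ ^ n := by ring
  -- half-line bounds: on `[a', ∞)`, shells `≤ n+1` are bounded by `Bm = B √κ₂ e^{-a'} ρ^{n+1}`
  have hJ : ∀ a' : ℝ, ∃ J : ℕ, ∀ j, J ≤ j → av j < a' := fun a' =>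
    eventually_atTop.1 (hav.eventually (eventually_lt_atBot a'))
  have hhalf : ∀ (n k : ℤ) (a' : ℝ), k ≤ n + 1 → ∀ (j : ℕ) (u : ℝ), av j < a' → a' ≤ u →
      ‖g j k u‖ ≤ B * Real.sqrt κ₂ * Real.exp (-a') * ρ ^ (n + 1) := by
    intro n k a' hk j u hja hu
    have h := hgb j k u (lt_of_lt_of_le hja hu)
    have h1 : Real.exp (-u) ≤ Real.exp (-a') := Real.exp_le_exp.2 (by linarith)
    have h2 : ρ ^ k ≤ ρ ^ (n + 1) := zpow_le_zpow_right₀ hρ1 hk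
    calc ‖g j k u‖ ≤ B * Real.sqrt κ₂ * Real.exp (-u) * ρ ^ k := h
      _ ≤ B * Real.sqrt κ₂ * Real.exp (-a') * ρ ^ (n + 1) :=
          mul_le_mul (mul_le_mul_of_nonneg_left h1 (by positivity)) h2 (zpow_pos hρ _).le (by positivity)
  -- Arzelà–Ascoli inputs
  have hAB : ∀ (n : ℤ) (a' : ℝ), ∃ C' : ℝ, ∃ J : ℕ, ∀ j, J ≤ j → ∀ u : ℝ, a' ≤ u → ‖g j n u‖ ≤ C' := by
    intro n a'
    obtain ⟨J, hJ'⟩ := hJ a'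
    exact ⟨_, J, fun j hj u hu => hhalf n n a' (by linarith) j u (hJ' j hj) hu⟩
  have hAL : ∀ (n : ℤ) (a' : ℝ), ∃ K' : ℝ, ∃ J : ℕ, ∀ j, J ≤ j → ∀ u v : ℝ, a' ≤ u → a' ≤ v →
      ‖g j n u - g j n v‖ ≤ K' * |u - v| := by
    intro n a'
    obtain ⟨J, hJ'⟩ := hJ a'
    set Bm : ℝ := B * Real.sqrt κ₂ * Real.exp (-a') * ρ ^ (n + 1) with hBm
    have hBm0 : 0 ≤ Bm := by positivity
    set K : ℝ := Bm + shiftConst α (0, 0, 0) * Bm ^ 2 + ‖bigLam ε₀‖ * (shiftConst α (0, 0, 1) * Bm ^ 2)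
      + ‖(bigLam ε₀)⁻¹‖ * ((shiftConst α (1, 0, 0) + shiftConst α (0, 1, 0)) * Bm * Bm) with hK
    have hlip : ∀ j, J ≤ j → ∀ u v : ℝ, a' ≤ u → u ≤ v → ‖g j n v - g j n u‖ ≤ K * (v - u) := by
      intro j hj u v hu huv
      have hderiv : ∀ t ∈ Icc u v, HasDerivWithinAt (g j n)
          (-((1 : ℝ) • g j n t) + tableQ α (g j n t) + bigLam ε₀ • tableA α (g j (n - 1) t)
            + (bigLam ε₀)⁻¹ • tableB α (g j (n + 1) t) (g j n t)) (Icc u v) t := fun t ht =>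
        (hlawg j n t (lt_of_lt_of_le (hJ' j hj) (hu.trans ht.1))).hasDerivWithinAt
      have hbound : ∀ t ∈ Ico u v,
          ‖-((1 : ℝ) • g j n t) + tableQ α (g j n t) + bigLam ε₀ • tableA α (g j (n - 1) t)
            + (bigLam ε₀)⁻¹ • tableB α (g j (n + 1) t) (g j n t)‖ ≤ K := fun t ht =>
        norm_eternalLaw_rhs_le ε₀ α hBm0 (hhalf n n a' (by linarith) j t (hJ' j hj) (hu.trans ht.1))
          (hhalf n (n - 1) a' (by linarith) j t (hJ' j hj) (hu.trans ht.1))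
          (hhalf n (n + 1) a' le_rfl j t (hJ' j hj) (hu.trans ht.1))
      exact norm_image_sub_le_of_norm_deriv_le_segment' hderiv hbound v (right_mem_Icc.2 huv)
    refine ⟨K, J, fun j hj u v hu hv => ?_⟩
    rcases le_total u v with huv | hvu
    · rw [norm_sub_rev, abs_sub_comm, abs_of_nonneg (by linarith)]
      exact hlip j hj u v hu huv
    · rw [abs_of_nonneg (by linarith)]
      exact hlip j hj v u hv hvu
  obtain ⟨φ, hφ, Wlim, hconv⟩ := exists_subseq_continuousLimit g hAB hAL
  -- the limit solves the law (LOCAL closure) and is continuous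
  have hav' : Tendsto (fun j => av (φ j)) atTop atBot := hav.comp hφ.tendsto_atTop
  have hs' : Tendsto (fun j => s (φ j)) atTop atTop := hs.comp hφ.tendsto_atTop
  have hlaw' : ∀ (j : ℕ) (n : ℤ) (u : ℝ), av (φ j) < u → HasDerivAt (g (φ j) n)
      (-((1 : ℝ) • g (φ j) n u) + tableQ α (g (φ j) n u) + bigLam ε₀ • tableA α (g (φ j) (n - 1) u)
        + (bigLam ε₀)⁻¹ • tableB α (g (φ j) (n + 1) u) (g (φ j) n u)) u := fun j n u hu =>
    hlawg (φ j) n u hu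
  have hbd' : ∀ (n : ℤ) (a' : ℝ), ∃ B' : ℝ, ∀ᶠ j in atTop, ∀ u : ℝ, a' ≤ u → ‖g (φ j) n u‖ ≤ B' := by
    intro n a'
    refine ⟨B * Real.sqrt κ₂ * Real.exp (-a') * ρ ^ (n + 1), ?_⟩
    exact (hav'.eventually (eventually_lt_atBot a')).mono fun j hj u hu => hhalf n n a' (by linarith) (φ j) u hj hu
  have hlaw : ∀ (n : ℤ) (σ : ℝ), HasDerivAt (Wlim n) (-((1 : ℝ) • Wlim n σ) + tableQ α (Wlim n σ)
      + bigLam ε₀ • tableA α (Wlim (n - 1) σ) + (bigLam ε₀)⁻¹ • tableB α (Wlim (n + 1) σ) (Wlim n σ)) σ :=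
    fun n σ => eternalLaw_of_continuousLimit_local (V := fun j => g (φ j)) hlaw' hbd' hav' hconv n σ
  have hcont : ∀ n : ℤ, Continuous (Wlim n) := fun n =>
    continuous_iff_continuousAt.2 fun σ => (hlaw n σ).continuousAt
  have hpt : ∀ (n : ℤ) (σ : ℝ), Tendsto (fun j => g (φ j) n σ) atTop (𝓝 (Wlim n σ)) :=
    fun n σ => hconv n (fun _ => σ) σ tendsto_const_nhds
  -- windows open eventually along `φ`
  have hev : ∀ a' : ℝ, ∀ᶠ j in atTop, av (φ j) < a' := fun a' => hav'.eventually (eventually_lt_atBot a')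
  -- ACTION on finite windows, then on `ℝ`
  have hwin_int : ∀ (n : ℤ) (a' b : ℝ), a' ≤ b → ∫ u in a'..b, ‖Wlim n u‖ ≤ A := by
    intro n a' b hab
    have hlim : Tendsto (fun j => ∫ u in a'..b, ‖g (φ j) n u‖) atTop (𝓝 (∫ u in a'..b, ‖Wlim n u‖)) := by
      refine intervalIntegral.tendsto_integral_filter_of_dominated_convergence
        (fun _ => B * Real.sqrt κ₂ * Real.exp (-a') * ρ ^ (n + 1)) ?_ ?_ intervalIntegrable_const ?_
      · refine (hev a').mono fun j hj => ?_
        refine ContinuousOn.aestronglyMeasurable ?_ measurableSet_uIoc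
        intro u hu
        rw [Set.uIoc_of_le hab] at hu
        exact ((hlawg (φ j) n u (lt_trans hj hu.1)).continuousAt.norm).continuousWithinAt
      · refine (hev a').mono fun j hj => ae_of_all _ fun u hu => ?_
        rw [Set.uIoc_of_le hab] at hu
        rw [norm_norm]
        exact hhalf n n a' (by linarith) (φ j) u hj hu.1.le
      · exact ae_of_all _ fun u _ => (hpt n u).norm
    refine le_of_tendsto hlim ((hev a').mono fun j hj => ?_)
    have hwa : Real.exp (-(a' + s (φ j))) < T := hwin (φ j) a' hj
    exact translate_window_action hε hC1 hW hact (n + ((φ j : ℕ) : ℤ)) (s (φ j)) hab hwa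
  have haction : ∀ n : ℤ, Integrable (fun σ => ‖Wlim n σ‖) ∧ ∫ σ, ‖Wlim n σ‖ ≤ A := by
    intro n
    have hcn : Continuous (fun σ => ‖Wlim n σ‖) := (hcont n).norm
    have hfi : ∀ i : ℕ, IntegrableOn (fun σ => ‖Wlim n σ‖) (Ioc (-(i : ℝ)) i) := fun i =>
      (hcn.integrableOn_Icc).mono_set Ioc_subset_Icc_self
    have ha : Tendsto (fun i : ℕ => -(i : ℝ)) atTop atBot :=
      tendsto_neg_atTop_atBot.comp tendsto_natCast_atTop_atTop
    have hb : Tendsto (fun i : ℕ => (i : ℝ)) atTop atTop := tendsto_natCast_atTop_atTop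
    have hii : ∀ i : ℕ, -(i : ℝ) ≤ i := fun i => by
      have h0 : (0 : ℝ) ≤ i := Nat.cast_nonneg i
      linarith
    have hInt : Integrable (fun σ => ‖Wlim n σ‖) := by
      refine integrable_of_intervalIntegral_norm_bounded A hfi ha hb (Eventually.of_forall fun i => ?_)
      simp only [norm_norm]
      exact hwin_int n _ _ (hii i)
    exact ⟨hInt, le_of_tendsto' (intervalIntegral_tendsto_integral hInt ha hb) fun i => hwin_int n _ _ (hii i)⟩
  -- ENVELOPE in the limit (energy ceiling `B² (ν²)^k`, clock-compatibility `M = κ₂`)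
  have hE : ∀ (k : ℤ) (t : ℝ), 0 ≤ t → t < T → ‖shellVec X k t‖ ^ 2 ≤ B ^ 2 * (ν ^ 2) ^ k := by
    intro k t ht0 htT
    have h := pow_le_pow_left₀ (norm_nonneg _) (hamp k t ht0 htT) 2
    rwa [mul_pow, zpow_sq_comm] at h
  have hνsq : 0 < ν ^ 2 := by positivity
  have henv : ∀ (n : ℤ) (σ : ℝ), Real.exp (2 * σ) * ‖Wlim n σ‖ ^ 2 ≤ B ^ 2 * κ₂ * q ^ n := by
    intro n σ
    have hqn : 0 < q ^ n := zpow_pos hq _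
    refine le_of_tendsto ((((hpt n σ).norm).pow 2).const_mul (Real.exp (2 * σ))) ((hev σ).mono fun j hj => ?_)
    have h1 := translate_envelope hε hW hνsq hE n ((φ j : ℕ) : ℤ) (s (φ j)) σ (hwin (φ j) σ hj)
    have hM : (bigLam ε₀ ^ 2 * ν ^ 2) ^ ((φ j : ℕ) : ℤ) * Real.exp (-(2 * s (φ j))) ≤ κ₂ := by
      have e : Real.exp (-(2 * s (φ j))) = (T - τ (φ j)) ^ 2 := by
        rw [hs_def]
        simp only [neg_neg, mul_neg]
        rw [two_mul, Real.exp_add, Real.exp_log (gap (φ j)), sq]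
      rw [zpow_natCast, e]
      exact hclock₂ (φ j)
    calc Real.exp (2 * σ) * ‖g (φ j) n σ‖ ^ 2
        ≤ B ^ 2 * ((bigLam ε₀ ^ 2 * ν ^ 2) ^ ((φ j : ℕ) : ℤ) * Real.exp (-(2 * s (φ j)))) *
            (bigLam ε₀ ^ 2 * ν ^ 2) ^ n := h1
      _ = B ^ 2 * (((bigLam ε₀ ^ 2 * ν ^ 2) ^ ((φ j : ℕ) : ℤ) * Real.exp (-(2 * s (φ j)))) * q ^ n) := by
          rw [hq_def]; ring
      _ ≤ B ^ 2 * (κ₂ * q ^ n) :=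
          mul_le_mul_of_nonneg_left (mul_le_mul_of_nonneg_right hM hqn.le) (sq_nonneg _)
      _ = B ^ 2 * κ₂ * q ^ n := by ring
  -- SURVIVAL in the limit
  have hconvS : ∀ (n : ℤ) (v : ℕ → ℝ) (σ : ℝ), Tendsto v atTop (𝓝 σ) →
      Tendsto (fun j => W (n + ((φ j : ℕ) : ℤ)) (v j + -Real.log (T - τ (φ j)))) atTop (𝓝 (Wlim n σ)) :=
    fun n v σ hv => by simpa only using hconv n v σ hv
  have hsurv : EternalSurvivingFwd a ε₀ Wlim :=
    survivingFwd_of_firingLimit hε hW hνsq hcf hκ₁ hκ₂ hq1 hpw hτ hfloor hclock₁ hclock₂ (φ := φ) hconvS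
  exact ⟨Wlim, ⟨hlaw, ⟨A, haction⟩, fun n => ⟨0, B ^ 2 * κ₂ * q ^ n, fun σ _ => henv n σ⟩⟩, hsurv⟩

/-- **The case `a = 1`** of the type-I-free extraction: under the (S₁) clause `(1+ε₀)⁻¹ ≤ ν²` the thresholds
`Λ²ν² > 1` and `1 ≤ physWeight 1 ε₀ · Λ²ν²` are automatic, and the clocked front has an admissible eternal ω-limit that
is (S₁)-surviving forward — literally the conclusion `∃ W, IsEternal ε₀ α W ∧ EternalSurvivingFwd 1 ε₀ W` of the
registered stub `stub_eternalFromBlowup`, with NO type-I hypothesis.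
[cite: Tao2016AveragedNS, §4 Thm. 4.2 (statement shape), (4.8)–(4.10), §6.4; KochNadirashviliSereginSverak2009, Thm 1.1 ff.; cell vocabulary] -/
theorem eternal_surviving_one_of_clockedFront {ε₀ T A B ν cf κ₁ κ₂ : ℝ} (hε : 0 < ε₀) (hT : 0 < T)
    {α : Fin m → Fin m → Fin m → ℤ × ℤ × ℤ → ℝ}
    {X : Fin m → ℤ → ℝ → ℝ} (hC1 : ∀ i n, ContDiffOn ℝ 1 (X i n) (Set.Ico 0 T))
    (hmot : ∀ i n t, 0 ≤ t → t < T → derivWithin (X i n) (Set.Ici 0) t = quadTerm ε₀ α X i n t)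
    (hact : ∀ k : ℤ, IntegrableOn (fun t => ‖shellVec X k t‖) (Ico 0 T) ∧
      bigLam ε₀ ^ k * (∫ t in Ico 0 T, ‖shellVec X k t‖) ≤ A)
    (hν : 0 < ν) (hν1 : (1 + ε₀)⁻¹ ≤ ν ^ 2)
    (hamp : ∀ (j : ℤ) (t : ℝ), 0 ≤ t → t < T → ‖shellVec X j t‖ ≤ B * ν ^ j)
    {τ : ℕ → ℝ} (hτ : ∀ k : ℕ, 0 ≤ τ k ∧ τ k < T)
    (hfloor : ∀ k : ℕ, cf * (ν ^ 2) ^ k ≤ ‖shellVec X (k : ℤ) (τ k)‖ ^ 2)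
    (hclock₁ : ∀ k : ℕ, κ₁ ≤ (bigLam ε₀ ^ 2 * ν ^ 2) ^ k * (T - τ k) ^ 2)
    (hclock₂ : ∀ k : ℕ, (bigLam ε₀ ^ 2 * ν ^ 2) ^ k * (T - τ k) ^ 2 ≤ κ₂)
    (hcf : 0 < cf) (hκ₁ : 0 < κ₁) (hκ₂ : 0 < κ₂) :
    ∃ Wlim : ℤ → ℝ → Em m, IsEternal ε₀ α Wlim ∧ EternalSurvivingFwd 1 ε₀ Wlim := by
  have hb : (0 : ℝ) < 1 + ε₀ := by linarith
  have hpw : 1 ≤ physWeight 1 ε₀ * (bigLam ε₀ ^ 2 * ν ^ 2) :=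
    physWeight_mul_ge_one_of_surviving hε (a := 1) (by rwa [Real.rpow_neg_one])
  have hq1 : 1 < bigLam ε₀ ^ 2 * ν ^ 2 := by
    rw [bigLam_sq hε]
    have h4 : (1 : ℝ) < (1 + ε₀) ^ 4 := one_lt_pow₀ (by linarith) (by norm_num)
    have h5 : (1 + ε₀) ^ 4 ≤ (1 + ε₀) ^ 5 * ν ^ 2 := by
      calc (1 + ε₀) ^ 4 = (1 + ε₀) ^ 5 * (1 + ε₀)⁻¹ := by field_simp
        _ ≤ (1 + ε₀) ^ 5 * ν ^ 2 := mul_le_mul_of_nonneg_left hν1 (pow_pos hb 5).le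
    exact lt_of_lt_of_le h4 h5
  set W : ℤ → ℝ → Em m := fun n σ => (bigLam ε₀ ^ n * Real.exp (-σ)) • shellVec X n (T - Real.exp (-σ)) with hW
  exact eternal_surviving_of_clockedFront hε hT hC1 hmot (W := W) (fun n σ => rfl) hact hν hamp hτ hfloor hclock₁
    hclock₂ hcf hκ₁ hκ₂ hq1 hpw

/-- **THE REGISTERED STUB `stub_eternalFromBlowup` MODULO THE TYPE-I-FREE FRONT BUNDLE.** If below a threshold every robust
blow-up (`NoGlobalCascade ε₀ α X₀`) of a table `α ∈ E₂(R)` admits SOME exact flow of `α` on some `[0,T)` with a per-shell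
ACTION CEILING, an AMPLITUDE CEILING `B ν^j` at an (S₁)-surviving ratio `(1+ε₀)⁻¹ ≤ ν²`, and CLOCKED FIRING (floor
`c_f (ν²)^k` at times `τ_k ∈ [0,T)` with `κ₁ ≤ (Λ²ν²)^k (T-τ_k)² ≤ κ₂`, all `k ∈ ℕ`) — NO type-I bound — then the signature of
`stub_eternalFromBlowup` (skeleton `9d85f4d387c689cd` of item 20206) holds verbatim.
[cite: Tao2016AveragedNS, §4 Thm. 4.2, §6.4; KochNadirashviliSereginSverak2009, Thm 1.1 ff.; cell vocabulary (`NoGlobalCascade`, `IsEternal`, `EternalSurvivingFwd`)] -/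
theorem stub_eternalFromBlowup_of_clockedFronts
    (H : ∀ R : ℝ, 1 ≤ R → ∃ εs : ℝ, 0 < εs ∧ ∀ ε₀ : ℝ, 0 < ε₀ → ε₀ ≤ εs →
      ∀ (α : (Fin 4 → Fin 4 → Fin 4 → ℤ × ℤ × ℤ → ℝ)) (X₀ : Fin 4 → ℝ),
        InTableClass R α → NoGlobalCascade ε₀ α X₀ →
        ∃ (T A B ν cf κ₁ κ₂ : ℝ) (X : Fin 4 → ℤ → ℝ → ℝ) (τ : ℕ → ℝ), 0 < T ∧
          (∀ i n, ContDiffOn ℝ 1 (X i n) (Set.Ico 0 T)) ∧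
          (∀ i n t, 0 ≤ t → t < T → derivWithin (X i n) (Set.Ici 0) t = quadTerm ε₀ α X i n t) ∧
          (∀ k : ℤ, IntegrableOn (fun t => ‖shellVec X k t‖) (Ico 0 T) ∧
            bigLam ε₀ ^ k * (∫ t in Ico 0 T, ‖shellVec X k t‖) ≤ A) ∧
          0 < ν ∧ (1 + ε₀)⁻¹ ≤ ν ^ 2 ∧
          (∀ (j : ℤ) (t : ℝ), 0 ≤ t → t < T → ‖shellVec X j t‖ ≤ B * ν ^ j) ∧
          (∀ k : ℕ, 0 ≤ τ k ∧ τ k < T) ∧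
          (∀ k : ℕ, cf * (ν ^ 2) ^ k ≤ ‖shellVec X (k : ℤ) (τ k)‖ ^ 2) ∧
          (∀ k : ℕ, κ₁ ≤ (bigLam ε₀ ^ 2 * ν ^ 2) ^ k * (T - τ k) ^ 2) ∧
          (∀ k : ℕ, (bigLam ε₀ ^ 2 * ν ^ 2) ^ k * (T - τ k) ^ 2 ≤ κ₂) ∧
          0 < cf ∧ 0 < κ₁ ∧ 0 < κ₂) :
    ∀ R : ℝ, 1 ≤ R → ∃ εs : ℝ, 0 < εs ∧ ∀ ε₀ : ℝ, 0 < ε₀ → ε₀ ≤ εs →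
      ∀ (α : (Fin 4 → Fin 4 → Fin 4 → ℤ × ℤ × ℤ → ℝ)) (X₀ : Fin 4 → ℝ),
        Literature.Analysis.FluidPDE.TaoCascade.InTableClass R α →
        Literature.Analysis.FluidPDE.TaoCascade.NoGlobalCascade ε₀ α X₀ →
        ∃ W : ℤ → ℝ → Literature.Analysis.FluidPDE.TaoCascade.Em 4,
          Literature.Analysis.FluidPDE.TaoCascade.IsEternal ε₀ α W ∧
          Literature.Analysis.FluidPDE.TaoCascade.EternalSurvivingFwd 1 ε₀ W := by
  intro R hR
  obtain ⟨εs, hεs, hH⟩ := H R hR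
  refine ⟨εs, hεs, fun ε₀ hε hεle α X₀ hα hNG => ?_⟩
  obtain ⟨T, A, B, ν, cf, κ₁, κ₂, X, τ, hT, hC1, hmot, hact, hν, hν1, hamp, hτ, hfloor, hclock₁, hclock₂,
    hcf, hκ₁, hκ₂⟩ := hH ε₀ hε hεle α X₀ hα hNG
  exact eternal_surviving_one_of_clockedFront hε hT hC1 hmot hact hν hν1 hamp hτ hfloor hclock₁ hclock₂ hcf hκ₁ hκ₂

end BlowupRigidityOne

end Summit.NavierStokesRegularity.NavierStokesRegularity.Theorems

end
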